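import Mathlib

/-!
# LangWeilTransfer, support item `TameResolution` (stmt-ValiantsHypothesis-6378) — a transcendence
# basis stays a transcendence basis after an integer shear by an element made integral

Route `LangWeilTransfer` of `ValiantsHypothesis` (conditional route; honest framing: bookkeeping,
nothing here bears on VP ≠ VNP). Quantitative pass, step (C) of the roadmap note of val-lit-p6 g9
(the invariant of the quantitative Noether loop with a FIXED number `r` of parameters): if `T̄` is a
transcendence basis of `F₀ / ℚ` and `ξ` is algebraic over `ℚ[T̄']`, where `T̄'_k = T̄_k - w_k ξ`,
then `T̄'` is again a transcendence basis. Proof: `F₀` is algebraic over `ℚ[T̄]`, every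
`T̄_k = T̄'_k + w_k ξ` is algebraic over `ℚ[T̄']` (Mathlib `IsAlgebraic.adjoin_of_forall_isAlgebraic`),
and a family of `r = trdeg` elements over which `F₀` is algebraic is a transcendence basis
(`Algebra.IsAlgebraic.isTranscendenceBasis_of_lift_le_trdeg_of_finite`).

* `isAlgebraic_adjoin_shear`, `isTranscendenceBasis_shear`.
-/

noncomputable section

open MvPolynomial

-- the summit and the problem share the name `ValiantsHypothesis` (D-0017 single-conjunct layout)
set_option linter.dupNamespace false

namespace Summit.ValiantsHypothesis.ValiantsHypothesis.Theorems.LangWeilTransfer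

variable {F₀ : Type*} [Field F₀] [CharZero F₀] {r : ℕ}

/-- After the shear `T̄'_k = T̄_k - w_k ξ` with `ξ` algebraic over `ℚ[T̄']`, everything algebraic
over `ℚ[T̄]` is algebraic over `ℚ[T̄']`. -/
theorem isAlgebraic_adjoin_shear (T : Fin r → F₀) (w : Fin r → F₀) (ξ : F₀)
    (hξ : IsAlgebraic (Algebra.adjoin ℚ (Set.range fun k => T k - w k * ξ)) ξ)
    (hw : ∀ k, IsAlgebraic (Algebra.adjoin ℚ (Set.range fun k => T k - w k * ξ)) (w k))
    {a : F₀} (ha : IsAlgebraic (Algebra.adjoin ℚ (Set.range T)) a) :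
    IsAlgebraic (Algebra.adjoin ℚ (Set.range fun k => T k - w k * ξ)) a := by
  refine IsAlgebraic.adjoin_of_forall_isAlgebraic (fun x hx => ?_) ha
  obtain ⟨⟨k, rfl⟩, -⟩ := hx
  have hk : T k = (T k - w k * ξ) + w k * ξ := by ring
  rw [hk]
  refine IsAlgebraic.add ?_ ((hw k).mul hξ)
  have : (T k - w k * ξ) = algebraMap (Algebra.adjoin ℚ (Set.range fun k => T k - w k * ξ)) F₀
      ⟨_, Algebra.subset_adjoin ⟨k, rfl⟩⟩ := rfl
  rw [this]
  exact isAlgebraic_algebraMap _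

/-- **The sheared family is again a transcendence basis.** -/
theorem isTranscendenceBasis_shear (T : Fin r → F₀) (hT : IsTranscendenceBasis ℚ T) (w : Fin r → ℕ) (ξ : F₀)
    (hξ : IsAlgebraic (Algebra.adjoin ℚ (Set.range fun k => T k - (w k : F₀) * ξ)) ξ) :
    IsTranscendenceBasis ℚ (fun k => T k - (w k : F₀) * ξ) := by
  haveI : Algebra.IsAlgebraic (Algebra.adjoin ℚ (Set.range T)) F₀ := hT.isAlgebraic
  haveI : Algebra.IsAlgebraic (Algebra.adjoin ℚ (Set.range fun k => T k - (w k : F₀) * ξ)) F₀ := by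
    refine ⟨fun a => ?_⟩
    refine isAlgebraic_adjoin_shear T (fun k => (w k : F₀)) ξ hξ (fun k => ?_) (Algebra.IsAlgebraic.isAlgebraic a)
    have : ((w k : ℕ) : F₀) = algebraMap (Algebra.adjoin ℚ (Set.range fun k => T k - (w k : F₀) * ξ)) F₀ (w k : ℕ) := by
      rw [map_natCast]
    rw [this]
    exact isAlgebraic_algebraMap _
  refine Algebra.IsAlgebraic.isTranscendenceBasis_of_lift_le_trdeg_of_finite ℚ _ ?_
  rw [hT.lift_cardinalMk_eq_trdeg]

end Summit.ValiantsHypothesis.ValiantsHypothesis.Theorems.LangWeilTransfer
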